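import Mathlib
import HarnessLib
import Summits.Ventures.HSemireg.GridBarrierCornerLaw

/-!
# Venture HSemireg — THEOREM GRID, (ii) + (iii) composed: a ⊠-type two-node symbol with
`K`-conjugate data lives on a SPLIT Weil datum, every `n ≥ 1`

HONEST FRAMING. Lean leaf 3b for the computation cell `pub-hsemireg` (target seat t-5 gen 11; file of
record `run/shared/lean/pub/pub-hsemireg/target-g6/GRID-BARRIER-t5g9.md`, 2026-08-23), companion of
`GridBarrierCornerLaw.lean` (leaf 3a: the grid law `κκ' = r₁r₂ · ∏c · (t₁ − t₂)^{2n}` for a two-node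
symbol that is a product of two two-spinor factors, assuming the four corners independent) and of
`GridBarrierNormLaw.lean` (leaf 2: the norm-group arithmetic). THIS FILE proves, with no new
definitions:

* `corners_linearIndependent`: the four corners `{01, 23, 02, 13}` built from four blocks of `n ≥ 1`
  vectors are linearly independent in the exterior algebra as soon as the `4n` vectors are — they
  are four distinct members of Mathlib's independent family of `2n`-fold products
  (`exteriorPower.ιMulti_family_linearIndependent_field`) for the lexicographic order on
  `Fin 4 × Fin n`; `nodeFamily_linearIndependent`: the `4n` node vectors `νₐ(t₁), ν'_b(t₁), νₐ(t₂),
  ν'_b(t₂)` are independent when the coordinate vectors `xₐ, yₐ, x'_b, y'_b` are (`cₐ, c'_b ≠ 0`,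
  `t₁ ≠ t₂`: same span, same cardinality).
* The BRIDGE `gridLaw_conjugate_forces_eisensteinNorm`: with `K = ℚ(ω)` realised in any field `F` of
  characteristic `0` (`ω² + ω + 1 = 0`, conjugation `ω ↦ ω²`, `(ω − ω̄)² = −3`), `K`-conjugate data
  `r₁ = u + vω`, `r₂ = r̄₁ ≠ 0`, `t₁ − t₂ = β(ω − ω̄)` (`β ≠ 0`), Weil coefficients `κκ' = ηλλ̄`
  (`λ = a + bω ≠ 0`, dictionary sign `η = ±1`) and rational `P > 0`, the law
  `κκ' = r₁r₂·P·(t₁ − t₂)^{2n}` reads `a² − ab + b² = ±(u² − uv + v²)·P·(3β²)ⁿ` over `ℚ`, and leaf 2's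
  `gridLaw_signed_forces_eisensteinNorm` makes `P` an Eisenstein norm (for either sign).
* END TO END `boxType_conjugateNodes_forces_eisensteinNorm`: coordinate vectors independent, weights
  non-zero with `∏cₐ∏c'_b = P`, the two-node symbol with `K`-conjugate data equal to a product of two
  two-spinor factors on its grid ⇒ `P ∈ N(ℚ(ω)^*)` — SPLIT in the sense of
  [Deligne1982HodgeCycles, §4 Cor. 4.2] / [vanGeemen1994HodgeAV, Lemma 5.2];
  `not_boxType_conjugateNodes_prodTwo`: on the deciding data `∏c = 2` (`(1,1,1,2)`, `R1 = (1⁵,2)`,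
  `(1⁷,2)`) this is impossible for every `n ≥ 1`; `coordinateModel_linearIndependent`: the structural
  hypothesis holds in the coordinate model `F^{4×n}` (non-vacuity).
* NOT FORMALISED (pencil + machine in the note): the symbol dictionary (§1), «⊠-type ⇒ product on
  THIS grid» (§2–§3), corner reality ⇒ `K`-conjugate nodes (§4). No object is constructed, no
  semiregularity map is computed; nothing here bears on HC, HC_CM or HC_AV.
-/

namespace Summit.Ventures.HSemireg

open ExteriorAlgebra

/-! ## Independence of the four corners from independence of the coordinate vectors -/

section Independence

variable {F : Type*} [Field F] {M : Type*} [AddCommGroup M] [Module F M] {n : ℕ}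

/-- The increasing enumeration of two blocks `i < j` of `Lex (Fin 4 × Fin n)`: first `(i, 0 … n−1)`,
then `(j, 0 … n−1)`. [folklore] -/
theorem blockPair_strictMono (i j : Fin 4) (hij : i < j) :
    StrictMono (fun p : Fin (n + n) =>
      if h : (p : ℕ) < n then toLex (i, (⟨p, h⟩ : Fin n))
      else toLex (j, (⟨p - n, by omega⟩ : Fin n))) := by
  intro p q hpq
  have hpq' : (p : ℕ) < q := hpq
  dsimp only
  by_cases hp : (p : ℕ) < n <;> by_cases hq : (q : ℕ) < n
  · rw [dif_pos hp, dif_pos hq, Prod.Lex.toLex_lt_toLex]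
    right; exact ⟨rfl, Fin.mk_lt_mk.mpr hpq'⟩
  · rw [dif_pos hp, dif_neg hq, Prod.Lex.toLex_lt_toLex]
    left; exact hij
  · exfalso; omega
  · rw [dif_neg hp, dif_neg hq, Prod.Lex.toLex_lt_toLex]
    right; exact ⟨rfl, Fin.mk_lt_mk.mpr (by omega)⟩

omit [AddCommGroup M] in
/-- Along that enumeration the family `(k, a) ↦ w k a` reads `Fin.append (w i) (w j)`. [folklore] -/
theorem blockPair_comp (w : Fin 4 → Fin n → M) (i j : Fin 4) :
    (fun p : Lex (Fin 4 × Fin n) => w (ofLex p).1 (ofLex p).2) ∘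
      (fun p : Fin (n + n) =>
        if h : (p : ℕ) < n then toLex (i, (⟨p, h⟩ : Fin n))
        else toLex (j, (⟨p - n, by omega⟩ : Fin n))) = Fin.append (w i) (w j) := by
  funext p
  refine Fin.addCases (fun a => ?_) (fun a => ?_) p
  · simp only [Function.comp_apply, Fin.append_left, Fin.val_castAdd, Fin.is_lt, dif_pos]
    rfl
  · simp only [Function.comp_apply, Fin.append_right, Fin.val_natAdd]
    rw [dif_neg (by omega)]
    simp

/-- **The four corners are linearly independent** in the exterior algebra as soon as the `4n`
vectors of the four blocks are (`n ≥ 1`): they are, in a suitable linear order, four distinct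
members of the standard independent family of `2n`-fold products
(`exteriorPower.ιMulti_family_linearIndependent_field`). Blocks `0,1,2,3` ↦ corners
`{01, 23, 02, 13}`. [folklore] -/
theorem corners_linearIndependent (hn : 0 < n) (w : Fin 4 → Fin n → M)
    (hw : LinearIndependent F (fun p : Fin 4 × Fin n => w p.1 p.2)) :
    LinearIndependent F
      ![(List.ofFn fun a => ι F (w 0 a)).prod * (List.ofFn fun a => ι F (w 1 a)).prod,
        (List.ofFn fun a => ι F (w 2 a)).prod * (List.ofFn fun a => ι F (w 3 a)).prod,
        (List.ofFn fun a => ι F (w 0 a)).prod * (List.ofFn fun a => ι F (w 2 a)).prod,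
        (List.ofFn fun a => ι F (w 1 a)).prod * (List.ofFn fun a => ι F (w 3 a)).prod] := by
  classical
  set v : Lex (Fin 4 × Fin n) → M := fun p => w (ofLex p).1 (ofLex p).2 with hv_def
  have hv : LinearIndependent F v := by
    have : v = (fun p : Fin 4 × Fin n => w p.1 p.2) ∘
        (ofLex : Lex (Fin 4 × Fin n) → Fin 4 × Fin n) := rfl
    rw [this]
    exact hw.comp _ ofLex.injective
  have hfam := exteriorPower.ιMulti_family_linearIndependent_field (n := n + n) hv
  have hfam' : LinearIndependent F (ExteriorAlgebra.ιMulti_family F (n + n) v) := by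
    rw [exteriorPower.ιMulti_family_eq_coe_comp]
    exact hfam.map' (⋀[F]^(n + n) M).subtype (Submodule.ker_subtype _)
  -- the order embeddings enumerating the block pairs
  let g : {q : Fin 4 × Fin 4 // q.1 < q.2} → (Fin (n + n) ↪o Lex (Fin 4 × Fin n)) :=
    fun q => OrderEmbedding.ofStrictMono _ (blockPair_strictMono q.1.1 q.1.2 q.2)
  let pairs : Fin 4 → {q : Fin 4 × Fin 4 // q.1 < q.2} :=
    ![⟨(0, 1), by decide⟩, ⟨(2, 3), by decide⟩, ⟨(0, 2), by decide⟩, ⟨(1, 3), by decide⟩]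
  let S : Fin 4 → Set.powersetCard (Lex (Fin 4 × Fin n)) (n + n) :=
    fun k => Set.powersetCard.ofFinEmbEquiv (g (pairs k))
  have hg0 : ∀ q, g q ⟨0, by omega⟩ = toLex (q.1.1, (⟨0, hn⟩ : Fin n)) := by
    intro q
    simp [g, hn]
  have hgn : ∀ q, g q ⟨n, by omega⟩ = toLex (q.1.2, (⟨0, hn⟩ : Fin n)) := by
    intro q
    simp [g]
  have hS : Function.Injective S := by
    intro k k' hkk'
    have h1 : g (pairs k) = g (pairs k') := Set.powersetCard.ofFinEmbEquiv.injective hkk'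
    have hi := congrArg
      (fun f : Fin (n + n) ↪o Lex (Fin 4 × Fin n) => (ofLex (f ⟨0, by omega⟩)).1) h1
    have hj := congrArg
      (fun f : Fin (n + n) ↪o Lex (Fin 4 × Fin n) => (ofLex (f ⟨n, by omega⟩)).1) h1
    simp only [hg0, hgn, ofLex_toLex] at hi hj
    fin_cases k <;> fin_cases k' <;> simp_all [pairs]
  have key := hfam'.comp S hS
  convert key using 1
  funext k
  have hident : ∀ q, ExteriorAlgebra.ιMulti_family F (n + n) v
      (Set.powersetCard.ofFinEmbEquiv (g q)) =
      (List.ofFn fun a => ι F (w q.1.1 a)).prod * (List.ofFn fun a => ι F (w q.1.2 a)).prod := by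
    intro q
    rw [ExteriorAlgebra.ιMulti_family, Equiv.symm_apply_apply, ← ιMulti_apply, ← ιMulti_apply,
      ιMulti_mul_ιMulti]
    congr 1
    have := blockPair_comp w q.1.1 q.1.2
    rw [← this]
    rfl
  fin_cases k <;> simp [S, pairs, hident]

/-- **The `4n` node vectors are independent** iff the `4n` coordinate vectors are: per slot,
`(νₐ(t₁), νₐ(t₂))` is an invertible recombination of `(xₐ, yₐ)` when `cₐ ≠ 0`, `t₁ ≠ t₂` (same
span, same cardinality). Blocks: `0 ↦ ν(t₁)`, `1 ↦ ν'(t₁)`, `2 ↦ ν(t₂)`, `3 ↦ ν'(t₂)` from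
`0 ↦ x`, `1 ↦ y`, `2 ↦ x'`, `3 ↦ y'`. [folklore] -/
theorem nodeFamily_linearIndependent (x y x' y' : Fin n → M) (c c' : Fin n → F) (t₁ t₂ : F)
    (hc : ∀ a, c a ≠ 0) (hc' : ∀ b, c' b ≠ 0) (ht : t₁ ≠ t₂)
    (hu : LinearIndependent F (fun p : Fin 4 × Fin n => (![x, y, x', y'] p.1) p.2)) :
    LinearIndependent F (fun p : Fin 4 × Fin n =>
      (![fun a => y a + (t₁ * c a) • x a, fun b => y' b + (t₁ * c' b) • x' b,
         fun a => y a + (t₂ * c a) • x a, fun b => y' b + (t₂ * c' b) • x' b] p.1) p.2) := by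
  rw [linearIndependent_iff_card_eq_finrank_span] at hu ⊢
  rw [hu]
  unfold Set.finrank
  have hΔ : t₁ - t₂ ≠ 0 := sub_ne_zero.mpr ht
  suffices hspan : Submodule.span F (Set.range (fun p : Fin 4 × Fin n => (![x, y, x', y'] p.1) p.2)) =
      Submodule.span F (Set.range (fun p : Fin 4 × Fin n =>
      (![fun a => y a + (t₁ * c a) • x a, fun b => y' b + (t₁ * c' b) • x' b,
         fun a => y a + (t₂ * c a) • x a, fun b => y' b + (t₂ * c' b) • x' b] p.1) p.2)) by
    rw [hspan]
  apply Submodule.span_eq_span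
  · -- old vectors in the span of the node vectors
    rintro _ ⟨⟨k, a⟩, rfl⟩
    set W := (fun p : Fin 4 × Fin n =>
      (![fun a => y a + (t₁ * c a) • x a, fun b => y' b + (t₁ * c' b) • x' b,
         fun a => y a + (t₂ * c a) • x a, fun b => y' b + (t₂ * c' b) • x' b] p.1) p.2) with hW
    have m0 : ∀ a, W (0, a) ∈ Submodule.span F (Set.range W) := fun a => Submodule.subset_span ⟨(0, a), rfl⟩
    have m1 : ∀ a, W (1, a) ∈ Submodule.span F (Set.range W) := fun a => Submodule.subset_span ⟨(1, a), rfl⟩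
    have m2 : ∀ a, W (2, a) ∈ Submodule.span F (Set.range W) := fun a => Submodule.subset_span ⟨(2, a), rfl⟩
    have m3 : ∀ a, W (3, a) ∈ Submodule.span F (Set.range W) := fun a => Submodule.subset_span ⟨(3, a), rfl⟩
    have hx : ∀ a, x a = (c a * (t₁ - t₂))⁻¹ • (W (0, a) - W (2, a)) := by
      intro a
      change x a = (c a * (t₁ - t₂))⁻¹ • ((y a + (t₁ * c a) • x a) - (y a + (t₂ * c a) • x a))
      rw [show y a + (t₁ * c a) • x a - (y a + (t₂ * c a) • x a) = (c a * (t₁ - t₂)) • x a by module,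
        smul_smul, inv_mul_cancel₀ (mul_ne_zero (hc a) hΔ), one_smul]
    have hy : ∀ a, y a = (t₁ - t₂)⁻¹ • (t₁ • W (2, a) - t₂ • W (0, a)) := by
      intro a
      change y a = (t₁ - t₂)⁻¹ • (t₁ • (y a + (t₂ * c a) • x a) - t₂ • (y a + (t₁ * c a) • x a))
      rw [show t₁ • (y a + (t₂ * c a) • x a) - t₂ • (y a + (t₁ * c a) • x a) = (t₁ - t₂) • y a by module,
        smul_smul, inv_mul_cancel₀ hΔ, one_smul]
    have hx' : ∀ b, x' b = (c' b * (t₁ - t₂))⁻¹ • (W (1, b) - W (3, b)) := by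
      intro b
      change x' b = (c' b * (t₁ - t₂))⁻¹ • ((y' b + (t₁ * c' b) • x' b) - (y' b + (t₂ * c' b) • x' b))
      rw [show y' b + (t₁ * c' b) • x' b - (y' b + (t₂ * c' b) • x' b) = (c' b * (t₁ - t₂)) • x' b by
          module, smul_smul, inv_mul_cancel₀ (mul_ne_zero (hc' b) hΔ), one_smul]
    have hy' : ∀ b, y' b = (t₁ - t₂)⁻¹ • (t₁ • W (3, b) - t₂ • W (1, b)) := by
      intro b
      change y' b = (t₁ - t₂)⁻¹ • (t₁ • (y' b + (t₂ * c' b) • x' b) - t₂ • (y' b + (t₁ * c' b) • x' b))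
      rw [show t₁ • (y' b + (t₂ * c' b) • x' b) - t₂ • (y' b + (t₁ * c' b) • x' b) = (t₁ - t₂) • y' b by
          module, smul_smul, inv_mul_cancel₀ hΔ, one_smul]
    fin_cases k
    · change x a ∈ _
      rw [hx a]
      exact Submodule.smul_mem _ _ (Submodule.sub_mem _ (m0 a) (m2 a))
    · change y a ∈ _
      rw [hy a]
      exact Submodule.smul_mem _ _ (Submodule.sub_mem _ (Submodule.smul_mem _ _ (m2 a))
        (Submodule.smul_mem _ _ (m0 a)))
    · change x' a ∈ _
      rw [hx' a]
      exact Submodule.smul_mem _ _ (Submodule.sub_mem _ (m1 a) (m3 a))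
    · change y' a ∈ _
      rw [hy' a]
      exact Submodule.smul_mem _ _ (Submodule.sub_mem _ (Submodule.smul_mem _ _ (m3 a))
        (Submodule.smul_mem _ _ (m1 a)))
  · -- node vectors in the span of the old vectors
    rintro _ ⟨⟨k, a⟩, rfl⟩
    set U := (fun p : Fin 4 × Fin n => (![x, y, x', y'] p.1) p.2) with hU
    have ux : ∀ a, x a ∈ Submodule.span F (Set.range U) := fun a => Submodule.subset_span ⟨(0, a), rfl⟩
    have uy : ∀ a, y a ∈ Submodule.span F (Set.range U) := fun a => Submodule.subset_span ⟨(1, a), rfl⟩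
    have ux' : ∀ b, x' b ∈ Submodule.span F (Set.range U) := fun b => Submodule.subset_span ⟨(2, b), rfl⟩
    have uy' : ∀ b, y' b ∈ Submodule.span F (Set.range U) := fun b => Submodule.subset_span ⟨(3, b), rfl⟩
    fin_cases k
    · change y a + (t₁ * c a) • x a ∈ _
      exact Submodule.add_mem _ (uy a) (Submodule.smul_mem _ _ (ux a))
    · change y' a + (t₁ * c' a) • x' a ∈ _
      exact Submodule.add_mem _ (uy' a) (Submodule.smul_mem _ _ (ux' a))
    · change y a + (t₂ * c a) • x a ∈ _
      exact Submodule.add_mem _ (uy a) (Submodule.smul_mem _ _ (ux a))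
    · change y' a + (t₂ * c' a) • x' a ∈ _
      exact Submodule.add_mem _ (uy' a) (Submodule.smul_mem _ _ (ux' a))

end Independence

/-! ## Bridge to the norm arithmetic (`GridBarrierNormLaw.lean`): `K = ℚ(ω)` realised inside any
field `F` of characteristic `0` containing a primitive cube root of unity `ω` (`ω² + ω + 1 = 0`);
conjugation `ω ↦ ω²`. -/

section Bridge

variable {F : Type*} [Field F] [CharZero F]

omit [CharZero F] in
/-- `(ω − ω̄)² = −3` for a primitive cube root of unity (`ω̄ = ω²`). [folklore] -/
theorem omega_sub_conj_sq {ω : F} (hω : ω ^ 2 + ω + 1 = 0) : (ω - ω ^ 2) ^ 2 = -3 := by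
  linear_combination (ω ^ 2 - 3 * ω + 3) * hω

/-- `ω ≠ ω̄`, so conjugate nodes `α₀ + βω`, `α₀ + βω̄` are distinct when `β ≠ 0`. [folklore] -/
theorem omega_sub_conj_ne_zero {ω : F} (hω : ω ^ 2 + ω + 1 = 0) : ω - ω ^ 2 ≠ 0 := by
  intro h
  have h3 := omega_sub_conj_sq hω
  rw [h] at h3
  norm_num at h3

omit [CharZero F] in
/-- `N(a + bω) = (a + bω)(a + bω̄) = a² − ab + b²`. [folklore] -/
theorem eisenstein_mul_conj {ω : F} (hω : ω ^ 2 + ω + 1 = 0) (a b : F) :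
    (a + b * ω) * (a + b * ω ^ 2) = a ^ 2 - a * b + b ^ 2 := by
  linear_combination (a * b + b ^ 2 * ω - b ^ 2) * hω

/-- **(ii) ⇒ (iii) through the bridge, every `n`.** If the grid law
`κκ' = r₁ r₂ · P · (t₁ − t₂)^{2n}` holds with `K`-CONJUGATE data — `r₁ = u + vω`, `r₂ = r̄₁`,
`t₁ − t₂ = β(ω − ω̄)` (`β ≠ 0`), `κκ' = η·λλ̄` with `λ = a + bω ≠ 0` (Weil-alive) and a dictionary
sign `η = ±1` — and `P = ∏ cₐ ∏ c'_b > 0` is rational, then `P` is a norm from `ℚ(ω)`: the Weil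
datum is SPLIT ([Deligne1982HodgeCycles, §4 Cor. 4.2]). Arithmetic from `GridBarrierNormLaw.lean`.
[folklore] -/
theorem gridLaw_conjugate_forces_eisensteinNorm (n : ℕ) {ω : F} (hω : ω ^ 2 + ω + 1 = 0)
    {a b u v β P η : ℚ} (hl : ¬ (a = 0 ∧ b = 0)) (hr : ¬ (u = 0 ∧ v = 0)) (hβ : β ≠ 0)
    (hP : 0 < P) (hη : η = 1 ∨ η = -1) {κ κ' : F}
    (hκ : κ * κ' = (η : F) * (((a : F) + b * ω) * ((a : F) + b * ω ^ 2)))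
    (hlaw : κ * κ' = ((u : F) + v * ω) * ((u : F) + v * ω ^ 2) * (P : F) *
      ((β : F) * (ω - ω ^ 2)) ^ (2 * n)) :
    ∃ x y : ℚ, x ^ 2 - x * y + y ^ 2 = P := by
  have hΔ : ((β : F) * (ω - ω ^ 2)) ^ (2 * n) = (((-1) ^ n * (3 * β ^ 2) ^ n : ℚ) : F) := by
    push_cast
    rw [pow_mul, mul_pow, omega_sub_conj_sq hω, ← mul_pow]
    congr 1
    ring
  rw [hκ, eisenstein_mul_conj hω, eisenstein_mul_conj hω, hΔ] at hlaw
  have hQ : η * (a ^ 2 - a * b + b ^ 2) = (u ^ 2 - u * v + v ^ 2) * P * ((-1) ^ n * (3 * β ^ 2) ^ n) := by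
    exact_mod_cast hlaw
  have hη2 : η * η = 1 := by rcases hη with rfl | rfl <;> norm_num
  have hlaw' : a ^ 2 - a * b + b ^ 2 =
      (η * (-1) ^ n) * ((u ^ 2 - u * v + v ^ 2) * P * (3 * β ^ 2) ^ n) := by
    calc a ^ 2 - a * b + b ^ 2 = η * (η * (a ^ 2 - a * b + b ^ 2)) := by
          rw [← mul_assoc, hη2, one_mul]
      _ = (η * (-1) ^ n) * ((u ^ 2 - u * v + v ^ 2) * P * (3 * β ^ 2) ^ n) := by rw [hQ]; ring
  have hε : η * (-1) ^ n = 1 ∨ η * (-1) ^ n = -1 := by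
    rcases hη with rfl | rfl <;> rcases neg_one_pow_eq_or ℚ n with h | h <;> simp [h]
  exact (gridLaw_signed_forces_eisensteinNorm n hl hr hβ hP hε hlaw').2

/-- On the deciding data `∏ c = 2` — `(1,1,1,2)`, `R1 = (1,1,1,1,1,2)`, `(1⁷,2)` — the conjugate-node
grid law is unsolvable for every `n` and either dictionary sign.
[cite: IrelandRosen1990, Ch. 9 §1 Prop. 9.1.4] -/
theorem gridLaw_conjugate_unsolvable_prodTwo (n : ℕ) {ω : F} (hω : ω ^ 2 + ω + 1 = 0)
    {a b u v β η : ℚ} (hl : ¬ (a = 0 ∧ b = 0)) (hr : ¬ (u = 0 ∧ v = 0)) (hβ : β ≠ 0)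
    (hη : η = 1 ∨ η = -1) {κ κ' : F}
    (hκ : κ * κ' = (η : F) * (((a : F) + b * ω) * ((a : F) + b * ω ^ 2))) :
    κ * κ' ≠ ((u : F) + v * ω) * ((u : F) + v * ω ^ 2) * ((2 : ℚ) : F) *
      ((β : F) * (ω - ω ^ 2)) ^ (2 * n) := by
  intro hlaw
  exact not_eisensteinNorm_two
    (gridLaw_conjugate_forces_eisensteinNorm n hω hl hr hβ (by norm_num) hη hκ hlaw)

end Bridge

/-! ## End to end: a ⊠-type two-node symbol with `K`-conjugate data lives on a split datum -/

section EndToEnd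

variable {F : Type*} [Field F] [CharZero F] {M : Type*} [AddCommGroup M] [Module F M]
variable {n : ℕ} (x y x' y' : Fin n → M) (c c' : Fin n → F)

/-- **THEOREM GRID (ii) + (iii), every `n ≥ 1`, kernel form.** In the exterior-algebra model of
the Hodge ring of a diagonal Weil datum — `V` with linearly independent coordinate vectors
`xₐ, yₐ` (σ-slots) and `x'_b, y'_b` (σ̄-slots), non-zero weights `cₐ`, `c'_b` with
`∏ cₐ ∏ c'_b = P ∈ ℚ_{>0}`, CM field `ℚ(ω) ⊂ F` — let `v` be a Weil-alive two-node class with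
`K`-conjugate nodes `t₁ = α₀ + βω`, `t₂ = α₀ + βω̄` (`β ≠ 0`), ranks `r₁ = u + vω`, `r₂ = r̄₁ ≠ 0`,
and Weil coefficients with `κκ' = ±N(λ)`, `λ = a + bω ≠ 0`; `Q₁, Q₂, Q₁', Q₂', W, W'` are the
node corners `Q[t₁], Q[t₂], Q'[t₁], Q'[t₂]` and the Weil corners `E, E'` (bound by their defining
equations). If the symbol `r₁Q₁Q₁' + r₂Q₂Q₂' + κW + κ'W'` is a product of two two-spinor factors on
the grid (the symbol class of a ⊠/secant-type object, note §0/§2), then `P` is a norm from `ℚ(ω)`: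
the datum is SPLIT ([Deligne1982HodgeCycles, §4 Cor. 4.2], [vanGeemen1994HodgeAV, Lemma 5.2]).
Pencil steps NOT formalised: the symbol dictionary (note §1), «⊠-type ⇒ product on THIS grid»
(uniqueness of the canonical pair, §2–§3) and corner reality (§4). [folklore] -/
theorem boxType_conjugateNodes_forces_eisensteinNorm (hn : 0 < n) {ω : F}
    (hω : ω ^ 2 + ω + 1 = 0) {a b u v α₀ β P η : ℚ} (hl : ¬ (a = 0 ∧ b = 0))
    (hr : ¬ (u = 0 ∧ v = 0)) (hβ : β ≠ 0) (hP : 0 < P) (hη : η = 1 ∨ η = -1)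
    (hc : ∀ a, c a ≠ 0) (hc' : ∀ b, c' b ≠ 0) (hCC : (∏ a, c a) * (∏ b, c' b) = (P : F))
    (hxy : LinearIndependent F (fun p : Fin 4 × Fin n => (![x, y, x', y'] p.1) p.2))
    {Q₁ Q₂ Q₁' Q₂' W W' : ExteriorAlgebra F M}
    (hQ₁ : Q₁ = (List.ofFn fun a : Fin n => ι F (y a + (((α₀ : F) + β * ω) * c a) • x a)).prod)
    (hQ₂ : Q₂ = (List.ofFn fun a : Fin n => ι F (y a + (((α₀ : F) + β * ω ^ 2) * c a) • x a)).prod)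
    (hQ₁' : Q₁' =
      (List.ofFn fun b : Fin n => ι F (y' b + (((α₀ : F) + β * ω) * c' b) • x' b)).prod)
    (hQ₂' : Q₂' =
      (List.ofFn fun b : Fin n => ι F (y' b + (((α₀ : F) + β * ω ^ 2) * c' b) • x' b)).prod)
    (hW : W = (List.ofFn fun a : Fin n => ι F (x a) * ι F (y a)).prod)
    (hW' : W' = (List.ofFn fun b : Fin n => ι F (x' b) * ι F (y' b)).prod)
    {κ κ' α α' δ δ' : F}
    (hκ : κ * κ' = (η : F) * (((a : F) + b * ω) * ((a : F) + b * ω ^ 2)))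
    (hbox : ((u : F) + v * ω) • (Q₁ * Q₁') + ((u : F) + v * ω ^ 2) • (Q₂ * Q₂') + κ • W + κ' • W' =
      (α • Q₁ + α' • Q₂') * (δ • Q₁' + δ' • Q₂)) :
    ∃ x y : ℚ, x ^ 2 - x * y + y ^ 2 = P := by
  have hβF : (β : F) ≠ 0 := by exact_mod_cast hβ
  have ht : (α₀ : F) + β * ω ≠ (α₀ : F) + β * ω ^ 2 := by
    intro h
    have : (β : F) * (ω - ω ^ 2) = 0 := by linear_combination h
    rcases mul_eq_zero.mp this with h0 | h0
    · exact hβF h0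
    · exact omega_sub_conj_ne_zero hω h0
  have hC : (∏ a, c a) ≠ 0 := Finset.prod_ne_zero_iff.mpr (fun a _ => hc a)
  have hC' : (∏ b, c' b) ≠ 0 := Finset.prod_ne_zero_iff.mpr (fun b _ => hc' b)
  have hnode := nodeFamily_linearIndependent x y x' y' c c' _ _ hc hc' ht hxy
  have hind' := corners_linearIndependent hn _ hnode
  have hind : LinearIndependent F ![Q₁ * Q₁', Q₂ * Q₂', Q₁ * Q₂, Q₁' * Q₂'] := by
    subst hQ₁ hQ₂ hQ₁' hQ₂'
    exact hind'
  have hlaw := gridLaw_of_boxProduct x y x' y' c c' _ _ hC hC' ht hQ₁ hQ₂ hQ₁' hQ₂' hW hW' hind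
    _ _ κ κ' α α' δ δ' hbox
  rw [hCC, show (α₀ : F) + β * ω - ((α₀ : F) + β * ω ^ 2) = (β : F) * (ω - ω ^ 2) by ring] at hlaw
  exact gridLaw_conjugate_forces_eisensteinNorm n hω hl hr hβ hP hη hκ hlaw

/-- **The deciding data, every `n ≥ 1`.** With `∏ cₐ ∏ c'_b = 2` — `(1,1,1,2)` (n = 2),
`R1 = (1,1,1,1,1,2)` (n = 3), `(1⁷,2)` (n = 4) — NO Weil-alive two-node class with
`ℚ(ω)`-conjugate data has a ⊠/secant-type symbol on its grid: `2` is not a norm from `ℚ(ω)`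
(`GridBarrierNormKernel.lean`). [cite: IrelandRosen1990, Ch. 9 §1 Prop. 9.1.4] -/
theorem not_boxType_conjugateNodes_prodTwo (hn : 0 < n) {ω : F} (hω : ω ^ 2 + ω + 1 = 0)
    {a b u v α₀ β η : ℚ} (hl : ¬ (a = 0 ∧ b = 0)) (hr : ¬ (u = 0 ∧ v = 0)) (hβ : β ≠ 0)
    (hη : η = 1 ∨ η = -1) (hc : ∀ a, c a ≠ 0) (hc' : ∀ b, c' b ≠ 0)
    (hCC : (∏ a, c a) * (∏ b, c' b) = 2)
    (hxy : LinearIndependent F (fun p : Fin 4 × Fin n => (![x, y, x', y'] p.1) p.2))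
    {Q₁ Q₂ Q₁' Q₂' W W' : ExteriorAlgebra F M}
    (hQ₁ : Q₁ = (List.ofFn fun a : Fin n => ι F (y a + (((α₀ : F) + β * ω) * c a) • x a)).prod)
    (hQ₂ : Q₂ = (List.ofFn fun a : Fin n => ι F (y a + (((α₀ : F) + β * ω ^ 2) * c a) • x a)).prod)
    (hQ₁' : Q₁' =
      (List.ofFn fun b : Fin n => ι F (y' b + (((α₀ : F) + β * ω) * c' b) • x' b)).prod)
    (hQ₂' : Q₂' =
      (List.ofFn fun b : Fin n => ι F (y' b + (((α₀ : F) + β * ω ^ 2) * c' b) • x' b)).prod)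
    (hW : W = (List.ofFn fun a : Fin n => ι F (x a) * ι F (y a)).prod)
    (hW' : W' = (List.ofFn fun b : Fin n => ι F (x' b) * ι F (y' b)).prod)
    {κ κ' α α' δ δ' : F}
    (hκ : κ * κ' = (η : F) * (((a : F) + b * ω) * ((a : F) + b * ω ^ 2))) :
    ((u : F) + v * ω) • (Q₁ * Q₁') + ((u : F) + v * ω ^ 2) • (Q₂ * Q₂') + κ • W + κ' • W' ≠
      (α • Q₁ + α' • Q₂') * (δ • Q₁' + δ' • Q₂) := by
  intro hbox
  have hCC' : (∏ a, c a) * (∏ b, c' b) = ((2 : ℚ) : F) := by rw [hCC]; norm_num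
  exact not_eisensteinNorm_two (boxType_conjugateNodes_forces_eisensteinNorm x y x' y' c c' hn hω
    hl hr hβ (by norm_num) hη hc hc' hCC' hxy hQ₁ hQ₂ hQ₁' hQ₂' hW hW' hκ hbox)

omit [CharZero F] in
/-- **Non-vacuity of the structural hypothesis.** In the coordinate model `V = F^{4 × n}` with
`xₐ, yₐ, x'_b, y'_b` the standard basis vectors, the hypothesis `hxy` of the two theorems above
holds. [folklore] -/
theorem coordinateModel_linearIndependent (n : ℕ) :
    LinearIndependent F (fun p : Fin 4 × Fin n =>
      (![fun a => (Pi.single (0, a) 1 : Fin 4 × Fin n → F), fun a => Pi.single (1, a) 1,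
         fun a => Pi.single (2, a) 1, fun a => Pi.single (3, a) 1] p.1) p.2) := by
  convert (Pi.basisFun F (Fin 4 × Fin n)).linearIndependent using 1
  funext p
  obtain ⟨k, a⟩ := p
  rw [Pi.basisFun_apply]
  fin_cases k <;> rfl

end EndToEnd

end Summit.Ventures.HSemireg
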